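import Mathlib
import Literature.Analysis.FluidPDE.NormalisedPressureSmooth
import Literature.Analysis.FluidPDE.EnergyToolkit
import Literature.Analysis.FluidPDE.LerayHopfH1Test
import HarnessLib

/-!
# Crux `EulerZoomLiouville.PowerGaugeEulerLiouville` (stmt-NavierStokesRegularity-19832), nsreg-p2 ROUND-58 plate t60-ΠLOG:
# PIECE (1′) — THE NEAR-FIELD `L¹` BOUND WITH THE LOGARITHM (from Stein near `p = 1`)

Seat ns-ezl-w3 g9 (`--supports stmt-NavierStokesRegularity-19832 --as helper`).  Text = nsreg-p2 g45's `NsregP2.R58b.NearFieldLog`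
(`r58/Sketch58b.lean` sha16 16d8b95ef8e183bb, §1 PIECE (1′)), derived here from the Stein bound WITH THE CONSTANT `C₀/(p−1)` on the
class `C²_c` (PIECE (1) `SteinNearOne` restricted to `C²` fields; the `C^∞_c` text of (1) reaches `C²_c` by mollification in the
companion file), exactly along the planner's derivation:

Hölder on `B_R` (`|B_R|^{1−1/p}`) · Stein with `p = 1 + s` (`C₀/s`) · Lebesgue interpolation `‖f‖_p^p ≤ ‖f‖₁^{(3−p)/2}‖f‖₃^{3(p−1)/2}`
(`f = |w|²`, tree `lintegral_rpow_interpolate`) · Gagliardo–Nirenberg–Sobolev `∫|w|⁶ ≤ K⁶(∫|∇w|²)³` (tree `integral_norm_pow_six_le`,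
`K` = Mathlib's constant) give, for every `s ∈ (0, 1]`,
`∫_{B_R}|p̃[w]| ≤ (C₀/s)·(m^{(2−s)/2}(K⁶e³)^{s/2})^{1/(1+s)}·(v₁R³)^{s/(1+s)} = (C₀/s)·m·X^{s/(2(1+s))}`, `X = (v₁R³)²K⁶e³/m³`
(`m = ∫|w|²`, `e = ∫|∇w|²`, `v₁ = |B_1|`); the choice `s = min(1, 2/log X)` yields `∫_{B_R}|p̃[w]| ≤ C₀·e·m·(1 + ½log⁺X)` and
`log⁺X ≤ log⁺(v₁²K⁶) + 3log⁺(R²e/m)` gives the planner's shape `C·m·(1 + log⁺(R²e/m))`.  Junk-safe at `m = 0` (both sides `0`).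

* `PressureSeam.setIntegral_abs_normalisedPressure_le_exponent` — the bound for one exponent `s ∈ (0,1]` (ℝ≥0∞ chain, real output);
* `PressureSeam.scaleFactor_eq_mul_exp` — the algebra `(m^{(2−s)/2}B^{s/2})^{1/(1+s)}V^{s/(1+s)} = m·exp((s/(2(1+s)))·log(V²B/m³))`;
* `PressureSeam.setIntegral_abs_normalisedPressure_le_log` — the optimisation in `s`;
* ★ `PressureSeam.nearFieldLog_of_steinBoundC2` — `NearFieldLog` VERBATIM (Sketch58b §1 (1′), `E3` spelled out) from the `C²_c` Stein bound.

HONEST FRAMING: instrument analysis about the normalised pressure of compactly supported fields; the Stein constant near `p = 1` is a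
HYPOTHESIS here (PIECE (1), its own hand); nothing about the crux E (19832 OPEN) or NS regularity is proved; not E.  MODEL lattice only.
-/

noncomputable section

-- flat `Theorems/<Route><Decl>…` files of one crux share the namespace of the crux (tree convention)
set_option linter.dupNamespace false

open MeasureTheory Metric Filter Topology
open scoped ENNReal NNReal

namespace Summit.NavierStokesRegularity.NavierStokesRegularity.Theorems.PowerGaugeEulerLiouville.PressureSeam

open Literature.Analysis.FluidPDE

/-- The normalised pressure of a `C²` compactly supported field is continuous (tree: `C^{n+2}_c ⇒ Cⁿ`). -/
theorem continuous_normalisedPressure_of_contDiff_two {w : EuclideanSpace ℝ (Fin 3) → EuclideanSpace ℝ (Fin 3)}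
    (hw : ContDiff ℝ 2 w) (hwc : HasCompactSupport w) : Continuous (normalisedPressure w) := by
  have hw' : ContDiff ℝ ((0 : ℕ∞) + 2 : ℕ∞) w := by simpa using hw
  exact contDiff_zero.1 (contDiff_normalisedPressure (n := 0) hw' hwc)

/-- **The near-field bound for ONE exponent.**  If `‖p̃[w]‖_p ≤ C₀(p−1)⁻¹‖|w|²‖_p` for `p ∈ (1,2]` and all `w ∈ C²_c`, then for
`R > 0`, `w ∈ C²_c` and `s ∈ (0,1]` (`p = 1+s`):
`∫_{B_R}|p̃[w]| ≤ (C₀/s)·((∫|w|²)^{(2−s)/2}·(K⁶(∫|∇w|²)³)^{s/2})^{1/(1+s)}·(|B_1|R³)^{s/(1+s)}`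
(Hölder on the ball, Stein, Lebesgue interpolation between `L¹` and `L³`, Gagliardo–Nirenberg–Sobolev). -/
theorem setIntegral_abs_normalisedPressure_le_exponent {C₀ : ℝ≥0}
    (hS : ∀ p : ℝ≥0∞, 1 < p → p ≤ 2 → ∀ w : EuclideanSpace ℝ (Fin 3) → EuclideanSpace ℝ (Fin 3),
      ContDiff ℝ 2 w → HasCompactSupport w →
        eLpNorm (normalisedPressure w) p volume ≤ (C₀ : ℝ≥0∞) / (p - 1) * eLpNorm (fun x => ‖w x‖ ^ 2) p volume)
    {R : ℝ} (hR : 0 < R) {w : EuclideanSpace ℝ (Fin 3) → EuclideanSpace ℝ (Fin 3)} (hw : ContDiff ℝ 2 w)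
    (hwc : HasCompactSupport w) {s : ℝ} (hs0 : 0 < s) (hs1 : s ≤ 1) :
    ∫ y in ball (0 : EuclideanSpace ℝ (Fin 3)) R, |normalisedPressure w y| ≤
      ((C₀ : ℝ) / s) *
        (((∫ y, ‖w y‖ ^ 2) ^ ((2 - s) / 2) *
            (((eLpNormLESNormFDerivOfEqInnerConst (volume : Measure (EuclideanSpace ℝ (Fin 3))) 2 : ℝ≥0) : ℝ) ^ 6 *
              (∫ y, ‖fderiv ℝ w y‖ ^ 2) ^ 3) ^ (s / 2)) ^ (1 / (1 + s))) *
        (((volume (ball (0 : EuclideanSpace ℝ (Fin 3)) 1)).toReal * R ^ 3) ^ (s / (1 + s))) := by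
  -- abbreviations
  set K : ℝ := ((eLpNormLESNormFDerivOfEqInnerConst (volume : Measure (EuclideanSpace ℝ (Fin 3))) 2 : ℝ≥0) : ℝ) with hK
  have hK0 : 0 ≤ K := NNReal.coe_nonneg _
  set m : ℝ := ∫ y, ‖w y‖ ^ 2 with hm
  set e : ℝ := ∫ y, ‖fderiv ℝ w y‖ ^ 2 with he
  have hm0 : 0 ≤ m := integral_nonneg fun _ => by positivity
  have he0 : 0 ≤ e := integral_nonneg fun _ => by positivity
  set B : ℝ := K ^ 6 * e ^ 3 with hB
  have hB0 : 0 ≤ B := by positivity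
  set v₁ : ℝ := (volume (ball (0 : EuclideanSpace ℝ (Fin 3)) 1)).toReal with hv₁
  have hv₁0 : 0 ≤ v₁ := ENNReal.toReal_nonneg
  -- the exponent
  set p : ℝ := 1 + s with hp
  have hp1 : 1 < p := by rw [hp]; linarith
  have hp2 : p ≤ 2 := by rw [hp]; linarith
  have hp0 : 0 < p := by linarith
  set pE : ℝ≥0∞ := ENNReal.ofReal p with hpE
  have hpE1 : 1 < pE := by
    rw [hpE, ← ENNReal.ofReal_one]; exact (ENNReal.ofReal_lt_ofReal_iff hp0).2 hp1
  have hpE2 : pE ≤ 2 := by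
    rw [hpE, show (2 : ℝ≥0∞) = ENNReal.ofReal 2 by simp]; exact ENNReal.ofReal_le_ofReal hp2
  have hpE0 : pE ≠ 0 := (zero_lt_one.trans hpE1).ne'
  have hpEt : pE ≠ ⊤ := ENNReal.ofReal_ne_top
  have hpEr : pE.toReal = p := ENNReal.toReal_ofReal hp0.le
  -- continuity and integrability of the pressure
  have hPc : Continuous (normalisedPressure w) := continuous_normalisedPressure_of_contDiff_two hw hwc
  have hPint : IntegrableOn (normalisedPressure w) (ball (0 : EuclideanSpace ℝ (Fin 3)) R) volume :=
    (hPc.continuousOn.integrableOn_compact (isCompact_closedBall (0 : EuclideanSpace ℝ (Fin 3)) R)).mono_set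
      ball_subset_closedBall
  -- (a) the real integral as a lower integral
  have ha : ENNReal.ofReal (∫ y in ball (0 : EuclideanSpace ℝ (Fin 3)) R, |normalisedPressure w y|) =
      ∫⁻ y in ball (0 : EuclideanSpace ℝ (Fin 3)) R, ‖normalisedPressure w y‖ₑ := by
    rw [← ofReal_integral_norm_eq_lintegral_enorm hPint]
    simp only [Real.norm_eq_abs]
  -- (b) Hölder on the ball
  have hb : ∫⁻ y in ball (0 : EuclideanSpace ℝ (Fin 3)) R, ‖normalisedPressure w y‖ₑ ≤
      eLpNorm (normalisedPressure w) pE (volume.restrict (ball (0 : EuclideanSpace ℝ (Fin 3)) R)) *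
        (volume (ball (0 : EuclideanSpace ℝ (Fin 3)) R)) ^ (1 - 1 / p) := by
    have h := eLpNorm_le_eLpNorm_mul_rpow_measure_univ (μ := volume.restrict (ball (0 : EuclideanSpace ℝ (Fin 3)) R))
      hpE1.le hPc.aestronglyMeasurable.restrict
    rw [eLpNorm_one_eq_lintegral_enorm, Measure.restrict_apply_univ, hpEr, ENNReal.toReal_one] at h
    simpa only [one_div, inv_one] using h
  -- (c)+(d) Stein with the constant
  have hcd : eLpNorm (normalisedPressure w) pE (volume.restrict (ball (0 : EuclideanSpace ℝ (Fin 3)) R)) ≤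
      (C₀ : ℝ≥0∞) / ENNReal.ofReal s * eLpNorm (fun x => ‖w x‖ ^ 2) pE volume := by
    refine (eLpNorm_restrict_le _ _ _ _).trans ?_
    have h := hS pE hpE1 hpE2 w hw hwc
    have hsub : pE - 1 = ENNReal.ofReal s := by
      rw [hpE, ← ENNReal.ofReal_one, ← ENNReal.ofReal_sub _ zero_le_one, hp]
      congr 1; ring
    rwa [hsub] at h
  -- (e) interpolation between `L¹` and `L³` for `f = |w|²`, and Sobolev
  have hc2 : HasCompactSupport (fun y => ‖w y‖ ^ 2) :=
    hwc.norm.comp_left (g := fun t : ℝ => t ^ 2) (zero_pow two_ne_zero)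
  have hc6 : HasCompactSupport (fun y => ‖w y‖ ^ 6) :=
    hwc.norm.comp_left (g := fun t : ℝ => t ^ 6) (zero_pow (by norm_num))
  have hint2 : Integrable (fun y => ‖w y‖ ^ 2) volume :=
    (hw.continuous.norm.pow 2).integrable_of_hasCompactSupport hc2
  have hint6 : Integrable (fun y => ‖w y‖ ^ 6) volume :=
    (hw.continuous.norm.pow 6).integrable_of_hasCompactSupport hc6
  have h6 : ∫ y, ‖w y‖ ^ 6 ≤ B := by
    have := integral_norm_pow_six_le (μ := (volume : Measure (EuclideanSpace ℝ (Fin 3))))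
      (finrank_euclideanSpace_fin (𝕜 := ℝ) (n := 3)) (hw.of_le (by norm_num)) hwc
    simpa only [hB, hK, he] using this
  have he' : eLpNorm (fun x => ‖w x‖ ^ 2) pE volume ≤
      ENNReal.ofReal ((m ^ ((2 - s) / 2) * B ^ (s / 2)) ^ (1 / (1 + s))) := by
    rw [eLpNorm_eq_lintegral_rpow_enorm_toReal hpE0 hpEt, hpEr]
    -- the integrand as `ofReal`
    have hf : ∀ y, ‖(‖w y‖ ^ 2 : ℝ)‖ₑ = ENNReal.ofReal (‖w y‖ ^ 2) := fun y =>
      Real.enorm_eq_ofReal (by positivity)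
    simp_rw [hf]
    have hfm : AEMeasurable (fun y => ENNReal.ofReal (‖w y‖ ^ 2)) volume :=
      (hw.continuous.norm.pow 2).measurable.ennreal_ofReal.aemeasurable
    have hI := lintegral_rpow_interpolate (μ := volume) hfm zero_lt_one (by norm_num : (1 : ℝ) < 3) hp1.le
      (by linarith : p ≤ 3)
    -- the two end-point integrals
    have hI1 : ∫⁻ y, ENNReal.ofReal (‖w y‖ ^ 2) ^ (1 : ℝ) = ENNReal.ofReal m := by
      simp_rw [ENNReal.rpow_one]
      rw [hm, ofReal_integral_eq_lintegral_ofReal hint2 (ae_of_all _ fun y => by positivity)]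
    have hI3 : ∫⁻ y, ENNReal.ofReal (‖w y‖ ^ 2) ^ (3 : ℝ) ≤ ENNReal.ofReal B := by
      have h3 : ∀ y, ENNReal.ofReal (‖w y‖ ^ 2) ^ (3 : ℝ) = ENNReal.ofReal (‖w y‖ ^ 6) := fun y => by
        rw [ENNReal.ofReal_rpow_of_nonneg (by positivity) (by norm_num)]
        congr 1
        rw [show (3 : ℝ) = ((3 : ℕ) : ℝ) by norm_num, Real.rpow_natCast]
        ring
      simp_rw [h3]
      rw [← ofReal_integral_eq_lintegral_ofReal hint6 (ae_of_all _ fun y => by positivity)]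
      exact ENNReal.ofReal_le_ofReal h6
    have hexp1 : (3 - p) / (3 - 1) = (2 - s) / 2 := by rw [hp]; ring
    have hexp2 : (p - 1) / (3 - 1) = s / 2 := by rw [hp]; ring
    rw [hexp1, hexp2, hI1] at hI
    have hs2 : 0 ≤ s / 2 := by positivity
    have h2s : 0 ≤ (2 - s) / 2 := by linarith
    calc (∫⁻ y, ENNReal.ofReal (‖w y‖ ^ 2) ^ p) ^ (1 / p)
        ≤ (ENNReal.ofReal m ^ ((2 - s) / 2) * (ENNReal.ofReal B) ^ (s / 2)) ^ (1 / p) := by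
          gcongr
          exact hI.trans (mul_le_mul' le_rfl (ENNReal.rpow_le_rpow hI3 hs2))
      _ = ENNReal.ofReal ((m ^ ((2 - s) / 2) * B ^ (s / 2)) ^ (1 / (1 + s))) := by
          rw [ENNReal.ofReal_rpow_of_nonneg hm0 h2s, ENNReal.ofReal_rpow_of_nonneg hB0 hs2,
            ← ENNReal.ofReal_mul (by positivity), ENNReal.ofReal_rpow_of_nonneg (by positivity) (by positivity), hp]
  -- (g) the volume of the ball
  have hg : (volume (ball (0 : EuclideanSpace ℝ (Fin 3)) R)) ^ (1 - 1 / p) = ENNReal.ofReal ((v₁ * R ^ 3) ^ (s / (1 + s))) := by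
    have hvol : volume (ball (0 : EuclideanSpace ℝ (Fin 3)) R) = ENNReal.ofReal (v₁ * R ^ 3) := by
      rw [Measure.addHaar_ball volume (0 : EuclideanSpace ℝ (Fin 3)) hR.le, finrank_euclideanSpace_fin, hv₁,
        mul_comm, ENNReal.ofReal_mul (by positivity), ENNReal.ofReal_toReal measure_ball_lt_top.ne]
    have hexp : 1 - 1 / p = s / (1 + s) := by rw [hp]; field_simp; ring
    rw [hvol, hexp, ENNReal.ofReal_rpow_of_nonneg (by positivity) (by positivity)]
  -- assembly in `ℝ≥0∞`, then back to `ℝ`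
  have hC : (C₀ : ℝ≥0∞) / ENNReal.ofReal s = ENNReal.ofReal ((C₀ : ℝ) / s) := by
    rw [ENNReal.ofReal_div_of_pos hs0, ENNReal.ofReal_coe_nnreal]
  have hchain : ENNReal.ofReal (∫ y in ball (0 : EuclideanSpace ℝ (Fin 3)) R, |normalisedPressure w y|) ≤
      ENNReal.ofReal (((C₀ : ℝ) / s) * ((m ^ ((2 - s) / 2) * B ^ (s / 2)) ^ (1 / (1 + s))) *
        ((v₁ * R ^ 3) ^ (s / (1 + s)))) := by
    rw [ha, ENNReal.ofReal_mul (by positivity), ENNReal.ofReal_mul (by positivity), ← hC, ← hg]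
    calc ∫⁻ y in ball (0 : EuclideanSpace ℝ (Fin 3)) R, ‖normalisedPressure w y‖ₑ
        ≤ eLpNorm (normalisedPressure w) pE (volume.restrict (ball (0 : EuclideanSpace ℝ (Fin 3)) R)) *
            (volume (ball (0 : EuclideanSpace ℝ (Fin 3)) R)) ^ (1 - 1 / p) := hb
      _ ≤ ((C₀ : ℝ≥0∞) / ENNReal.ofReal s * ENNReal.ofReal ((m ^ ((2 - s) / 2) * B ^ (s / 2)) ^ (1 / (1 + s)))) *
            (volume (ball (0 : EuclideanSpace ℝ (Fin 3)) R)) ^ (1 - 1 / p) :=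
          mul_le_mul' (hcd.trans (mul_le_mul' le_rfl he')) le_rfl
  exact (ENNReal.ofReal_le_ofReal_iff (by positivity)).1 hchain

/-- The scale factor in closed form: for `m, B, V > 0` and `s > −1`... (used with `s ∈ (0,1]`),
`(m^{(2−s)/2}·B^{s/2})^{1/(1+s)}·V^{s/(1+s)} = m·exp((s/(2(1+s)))·log(V²B/m³))`. -/
theorem scaleFactor_eq_mul_exp {m B V s : ℝ} (hm : 0 < m) (hB : 0 < B) (hV : 0 < V) (hs : 0 < s) :
    (m ^ ((2 - s) / 2) * B ^ (s / 2)) ^ (1 / (1 + s)) * V ^ (s / (1 + s)) =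
      m * Real.exp (s / (2 * (1 + s)) * Real.log (V ^ 2 * B / m ^ 3)) := by
  have hs1 : 0 < 1 + s := by linarith
  rw [Real.rpow_def_of_pos hm, Real.rpow_def_of_pos hB, ← Real.exp_add,
    Real.rpow_def_of_pos (Real.exp_pos _), Real.log_exp, Real.rpow_def_of_pos hV, ← Real.exp_add,
    Real.log_div (by positivity) (by positivity), Real.log_mul (by positivity) hB.ne', Real.log_pow, Real.log_pow]
  nth_rw 2 [← Real.exp_log hm]
  rw [← Real.exp_add]
  congr 1
  push_cast
  field_simp
  ring

/-- **The optimisation in the exponent.**  If `I ≤ (C₀/s)·(m^{(2−s)/2}B^{s/2})^{1/(1+s)}·V^{s/(1+s)}` for every `s ∈ (0,1]`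
(`C₀, m, B ≥ 0`, `V > 0`), then `I ≤ C₀·e·m·(1 + ½·log⁺(V²B/m³))` (`s = 1` when `log(V²B/m³) ≤ 2`, else `s = 2/log(V²B/m³)`;
the degenerate cases `m = 0` or `B = 0` give `I ≤ 0`). -/
theorem le_log_of_forall_exponent {I C₀ m B V : ℝ} (hC₀ : 0 ≤ C₀) (hm : 0 ≤ m) (hB : 0 ≤ B) (hV : 0 < V)
    (h : ∀ s : ℝ, 0 < s → s ≤ 1 →
      I ≤ (C₀ / s) * ((m ^ ((2 - s) / 2) * B ^ (s / 2)) ^ (1 / (1 + s)) * V ^ (s / (1 + s)))) :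
    I ≤ C₀ * Real.exp 1 * m * (1 + Real.posLog (V ^ 2 * B / m ^ 3) / 2) := by
  have hRHS0 : 0 ≤ C₀ * Real.exp 1 * m * (1 + Real.posLog (V ^ 2 * B / m ^ 3) / 2) := by
    have := Real.posLog_nonneg (x := V ^ 2 * B / m ^ 3)
    positivity
  -- degenerate cases
  rcases hm.eq_or_lt with hm0 | hm0
  · -- `m = 0`: the bound at `s = 1` vanishes
    have h1 := h 1 one_pos le_rfl
    rw [← hm0, Real.zero_rpow (by norm_num : ((2 : ℝ) - 1) / 2 ≠ 0), zero_mul,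
      Real.zero_rpow (by norm_num : (1 : ℝ) / (1 + 1) ≠ 0), zero_mul, mul_zero] at h1
    exact h1.trans hRHS0
  rcases hB.eq_or_lt with hB0 | hB0
  · -- `B = 0`: likewise
    have h1 := h 1 one_pos le_rfl
    rw [← hB0, Real.zero_rpow (by norm_num : (1 : ℝ) / 2 ≠ 0), mul_zero,
      Real.zero_rpow (by norm_num : (1 : ℝ) / (1 + 1) ≠ 0), zero_mul, mul_zero] at h1
    exact h1.trans hRHS0
  -- the generic case
  set L : ℝ := Real.log (V ^ 2 * B / m ^ 3) with hL
  have hkey : ∀ s : ℝ, 0 < s → s ≤ 1 →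
      I ≤ (C₀ / s) * (m * Real.exp (s / (2 * (1 + s)) * L)) := fun s hs0 hs1 => by
    have := h s hs0 hs1
    rwa [scaleFactor_eq_mul_exp hm0 hB0 hV hs0] at this
  have hpos : Real.posLog (V ^ 2 * B / m ^ 3) = max 0 L := by rw [Real.posLog_apply, hL]
  rcases le_or_gt L 2 with hL2 | hL2
  · -- `L ≤ 2`: take `s = 1`
    have h1 := hkey 1 one_pos le_rfl
    have hexp : Real.exp (1 / (2 * (1 + 1)) * L) ≤ Real.exp 1 := Real.exp_le_exp.2 (by linarith)
    calc I ≤ (C₀ / 1) * (m * Real.exp (1 / (2 * (1 + 1)) * L)) := h1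
      _ ≤ C₀ * (m * Real.exp 1) := by
          rw [div_one]; exact mul_le_mul_of_nonneg_left (mul_le_mul_of_nonneg_left hexp hm) hC₀
      _ = C₀ * Real.exp 1 * m * 1 := by ring
      _ ≤ C₀ * Real.exp 1 * m * (1 + Real.posLog (V ^ 2 * B / m ^ 3) / 2) := by
          refine mul_le_mul_of_nonneg_left ?_ (by positivity)
          linarith [Real.posLog_nonneg (x := V ^ 2 * B / m ^ 3)]
  · -- `L > 2`: take `s = 2/L`
    have hL0 : 0 < L := by linarith
    have hs0 : 0 < 2 / L := by positivity
    have hs1 : 2 / L ≤ 1 := (div_le_one hL0).2 hL2.le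
    have h1 := hkey (2 / L) hs0 hs1
    have hexp : Real.exp ((2 / L) / (2 * (1 + 2 / L)) * L) ≤ Real.exp 1 := by
      refine Real.exp_le_exp.2 ?_
      rw [show (2 / L) / (2 * (1 + 2 / L)) * L = 1 / (1 + 2 / L) by field_simp]
      rw [div_le_one (by positivity)]
      linarith [hs0.le]
    have hmax : Real.posLog (V ^ 2 * B / m ^ 3) = L := by rw [hpos, max_eq_right hL0.le]
    calc I ≤ (C₀ / (2 / L)) * (m * Real.exp ((2 / L) / (2 * (1 + 2 / L)) * L)) := h1
      _ ≤ (C₀ / (2 / L)) * (m * Real.exp 1) :=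
          mul_le_mul_of_nonneg_left (mul_le_mul_of_nonneg_left hexp hm) (by positivity)
      _ = C₀ * Real.exp 1 * m * (L / 2) := by field_simp
      _ ≤ C₀ * Real.exp 1 * m * (1 + Real.posLog (V ^ 2 * B / m ^ 3) / 2) := by
          rw [hmax]
          exact mul_le_mul_of_nonneg_left (by linarith) (by positivity)

/-- **The near-field bound with the logarithm, closed form** (from the `C²_c` Stein bound with constant `C₀/(p−1)`): for `R > 0` and
`w ∈ C²_c`, `∫_{B_R}|p̃[w]| ≤ C₀·e·m·(1 + ½log⁺((|B_1|R³)²·K⁶e³/m³))`, `m = ∫|w|²`, `e = ∫|∇w|²`. -/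
theorem setIntegral_abs_normalisedPressure_le_log {C₀ : ℝ≥0}
    (hS : ∀ p : ℝ≥0∞, 1 < p → p ≤ 2 → ∀ w : EuclideanSpace ℝ (Fin 3) → EuclideanSpace ℝ (Fin 3),
      ContDiff ℝ 2 w → HasCompactSupport w →
        eLpNorm (normalisedPressure w) p volume ≤ (C₀ : ℝ≥0∞) / (p - 1) * eLpNorm (fun x => ‖w x‖ ^ 2) p volume)
    {R : ℝ} (hR : 0 < R) {w : EuclideanSpace ℝ (Fin 3) → EuclideanSpace ℝ (Fin 3)} (hw : ContDiff ℝ 2 w)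
    (hwc : HasCompactSupport w) :
    ∫ y in ball (0 : EuclideanSpace ℝ (Fin 3)) R, |normalisedPressure w y| ≤
      (C₀ : ℝ) * Real.exp 1 * (∫ y, ‖w y‖ ^ 2) *
        (1 + Real.posLog (((volume (ball (0 : EuclideanSpace ℝ (Fin 3)) 1)).toReal * R ^ 3) ^ 2 *
          ((((eLpNormLESNormFDerivOfEqInnerConst (volume : Measure (EuclideanSpace ℝ (Fin 3))) 2 : ℝ≥0) : ℝ) ^ 6 *
            (∫ y, ‖fderiv ℝ w y‖ ^ 2) ^ 3)) / (∫ y, ‖w y‖ ^ 2) ^ 3) / 2) := by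
  have hv₁ : 0 < (volume (ball (0 : EuclideanSpace ℝ (Fin 3)) 1)).toReal :=
    ENNReal.toReal_pos (measure_ball_pos volume (0 : EuclideanSpace ℝ (Fin 3)) one_pos).ne' measure_ball_lt_top.ne
  refine le_log_of_forall_exponent (NNReal.coe_nonneg C₀) (integral_nonneg fun _ => by positivity) (by positivity)
    (by positivity) fun s hs0 hs1 => ?_
  exact (setIntegral_abs_normalisedPressure_le_exponent hS hR hw hwc hs0 hs1).trans_eq (mul_assoc _ _ _)

/-- ★ **PIECE (1′) `NearFieldLog` from the `C²_c` Stein bound near `p = 1`** (conclusion = Sketch58b §1 `NsregP2.R58b.NearFieldLog` VERBATIM,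
`E3` spelled out): `∫_{B_R}|p̃[w]| ≤ C·m·(1 + log⁺(R²e/m))` for `R ≥ 1`, `w ∈ C²_c`, with `C = (C₀+1)·e·(5 + log⁺(|B_1|²K⁶))/2`
(`log⁺((|B_1|R³)²K⁶e³/m³) ≤ log⁺(|B_1|²K⁶) + 3log⁺(R²e/m)`).  [nsreg-p2 R58 SEEDS-R58 S2, `r58/Sketch58b.lean` §1 (1′)] -/
theorem nearFieldLog_of_steinBoundC2 {C₀ : ℝ≥0}
    (hS : ∀ p : ℝ≥0∞, 1 < p → p ≤ 2 → ∀ w : EuclideanSpace ℝ (Fin 3) → EuclideanSpace ℝ (Fin 3),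
      ContDiff ℝ 2 w → HasCompactSupport w →
        eLpNorm (normalisedPressure w) p volume ≤ (C₀ : ℝ≥0∞) / (p - 1) * eLpNorm (fun x => ‖w x‖ ^ 2) p volume) :
    ∃ C : ℝ, 0 < C ∧ ∀ R : ℝ, 1 ≤ R → ∀ w : EuclideanSpace ℝ (Fin 3) → EuclideanSpace ℝ (Fin 3),
      ContDiff ℝ 2 w → HasCompactSupport w →
        IntegrableOn (normalisedPressure w) (ball (0 : EuclideanSpace ℝ (Fin 3)) R) volume ∧
        ∫ y in ball (0 : EuclideanSpace ℝ (Fin 3)) R, |normalisedPressure w y| ≤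
          C * (∫ y, ‖w y‖ ^ 2) *
            (1 + Real.posLog (R ^ 2 * (∫ y, ‖fderiv ℝ w y‖ ^ 2) / ∫ y, ‖w y‖ ^ 2)) := by
  set K : ℝ := ((eLpNormLESNormFDerivOfEqInnerConst (volume : Measure (EuclideanSpace ℝ (Fin 3))) 2 : ℝ≥0) : ℝ) with hK
  have hK0 : 0 ≤ K := NNReal.coe_nonneg _
  set v₁ : ℝ := (volume (ball (0 : EuclideanSpace ℝ (Fin 3)) 1)).toReal with hv₁
  have hv₁0 : 0 ≤ v₁ := ENNReal.toReal_nonneg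
  set A : ℝ := Real.posLog (v₁ ^ 2 * K ^ 6) with hA
  have hA0 : 0 ≤ A := Real.posLog_nonneg
  refine ⟨((C₀ : ℝ) + 1) * Real.exp 1 * ((5 + A) / 2), by positivity, fun R hR w hw hwc => ?_⟩
  have hR0 : 0 < R := by linarith
  have hPc : Continuous (normalisedPressure w) := continuous_normalisedPressure_of_contDiff_two hw hwc
  refine ⟨(hPc.continuousOn.integrableOn_compact (isCompact_closedBall (0 : EuclideanSpace ℝ (Fin 3)) R)).mono_set
    ball_subset_closedBall, ?_⟩
  set m : ℝ := ∫ y, ‖w y‖ ^ 2 with hm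
  set e : ℝ := ∫ y, ‖fderiv ℝ w y‖ ^ 2 with he
  have hm0 : 0 ≤ m := integral_nonneg fun _ => by positivity
  have he0 : 0 ≤ e := integral_nonneg fun _ => by positivity
  have h1 := setIntegral_abs_normalisedPressure_le_log hS hR0 hw hwc
  rw [← hK, ← hv₁, ← hm, ← he] at h1
  -- the logarithm of the product
  have hX : (v₁ * R ^ 3) ^ 2 * (K ^ 6 * e ^ 3) / m ^ 3 = (v₁ ^ 2 * K ^ 6) * (R ^ 2 * e / m) ^ 3 := by
    rw [div_pow]; ring
  have hlog : Real.posLog ((v₁ * R ^ 3) ^ 2 * (K ^ 6 * e ^ 3) / m ^ 3) ≤ A + 3 * Real.posLog (R ^ 2 * e / m) := by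
    rw [hX]
    refine (Real.posLog_mul).trans ?_
    rw [Real.posLog_pow, hA]
    push_cast
    rfl
  have hY0 : 0 ≤ Real.posLog (R ^ 2 * e / m) := Real.posLog_nonneg
  calc ∫ y in ball (0 : EuclideanSpace ℝ (Fin 3)) R, |normalisedPressure w y|
      ≤ (C₀ : ℝ) * Real.exp 1 * m * (1 + Real.posLog ((v₁ * R ^ 3) ^ 2 * (K ^ 6 * e ^ 3) / m ^ 3) / 2) := h1
    _ ≤ (C₀ : ℝ) * Real.exp 1 * m * (1 + (A + 3 * Real.posLog (R ^ 2 * e / m)) / 2) := by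
        refine mul_le_mul_of_nonneg_left (by linarith) (by positivity)
    _ ≤ ((C₀ : ℝ) + 1) * Real.exp 1 * ((5 + A) / 2) * m * (1 + Real.posLog (R ^ 2 * e / m)) := by
        have hC : (C₀ : ℝ) * Real.exp 1 ≤ ((C₀ : ℝ) + 1) * Real.exp 1 :=
          mul_le_mul_of_nonneg_right (by linarith) (Real.exp_pos 1).le
        have hq : 1 + (A + 3 * Real.posLog (R ^ 2 * e / m)) / 2 ≤ (5 + A) / 2 * (1 + Real.posLog (R ^ 2 * e / m)) := by
          nlinarith [hA0, hY0]
        calc (C₀ : ℝ) * Real.exp 1 * m * (1 + (A + 3 * Real.posLog (R ^ 2 * e / m)) / 2)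
            ≤ ((C₀ : ℝ) + 1) * Real.exp 1 * m * ((5 + A) / 2 * (1 + Real.posLog (R ^ 2 * e / m))) := by
              refine mul_le_mul (mul_le_mul_of_nonneg_right hC hm0) hq (by positivity) (by positivity)
          _ = ((C₀ : ℝ) + 1) * Real.exp 1 * ((5 + A) / 2) * m * (1 + Real.posLog (R ^ 2 * e / m)) := by ring

end Summit.NavierStokesRegularity.NavierStokesRegularity.Theorems.PowerGaugeEulerLiouville.PressureSeam

end
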